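import Mathlib.Analysis.SpecialFunctions.Pow.Real
import Literature.Computability.Complexity.CircuitClassesProofs
import Literature.Computability.Complexity.FormulaComposition
import Literature.Computability.Complexity.MonotoneFormulaBalancing
import Literature.Computability.MetaComplexity.FormulaModelsAE
import Literature.Computability.MetaComplexity.XorBottomModelsAE
import Literature.Computability.MetaComplexity.ChenJinWilliams2019.SparseFormulaMagnification
import Literature.Computability.MetaComplexity.ChenJinWilliams2019.SparseMagnificationConverse
import Literature.Computability.MetaComplexity.ChenJinWilliams2019.SparseFormulaMagnificationConverse
import HarnessLib

/-!
# Chen–Jin–Williams 2019, Theorem 1.1, converse of item 2 (`C = NP`, `U₂-Formula-⊕`) — proved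

Discharge (D-0014) of the vendored named fact
`Literature.Computability.MetaComplexity.ChenJinWilliams2019.thm11_item2_NP_converse`
(`SparseFormulaMagnification.lean`): `NPNotInFixedPolyFormulas → ∃ ε > 0, SparseNPFormulaXorHardAt ε`,
i.e. if for every `k` some `NP` language is outside `FORMULAae (n ↦ n^k)` (De Morgan formulas of
leaf size `n^k`, almost everywhere), then for every `β ∈ (0,1)` some `2^{n^β}`-sparse `NP` language
is outside `FORMULAXORae (n ↦ ⌈n^{1+ε}⌉)` (`U₂-Formula-⊕`: De Morgan formulas with parity leaves of
arbitrary arity, counted by leaves; here with `ε = 1`).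

Printed proof (L. Chen, C. Jin, R. R. Williams, *Hardness Magnification for all Sparse NP
Languages*, FOCS 2019; full version ECCC TR19-118, §4.1 p. 14, verbatim): *"The ⇐ direction can be
proved by a simple padding argument. Set `ε = 1`. For every `β ∈ (0, 1)`, by assumption, there is a
language `L_β ∈ NP` without `n^{2/β}` size circuits. Then we can define another language `L'_β ∈ NP`
as `{x10^{|x|^{1/β}−|x|−1} | x ∈ L_β}`. Clearly, `L'_β` does not have `n^{1+ε} = n²` size
circuits, and it is a `2^{n^β}`-sparse language. This padding argument also works for other
computational models (except the last two items in the theorem statement)."* For the model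
`U₂-Formula-⊕` of item 2 the padding argument uses, implicitly, that a `Formula-⊕` IS a (polynomially
larger) De Morgan formula — Chen–Hirahara–Oliveira–Pich–Rajgopal–Santhanam, *Beyond natural proofs*,
§1.1 note B, footnote: *"Note that Formula-XOR[N^{1.01}] ⊆ Formula[N^{3.01}]."* (each parity leaf
over `≤ N` variables is a De Morgan formula of `O(N²)` leaves).

## The formal proof (same argument, tree vocabulary)

The padded language is the tree's `polyPad q '' L = {⟨x, 1^{|x|^q}⟩ | x ∈ L}` (`q = ⌈1/β⌉`), with `NP`
membership and `2^{n^β}`-sparsity imported from `SparseMagnificationConverse.lean`, and the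
constant-free restriction of a De Morgan formula along the pad (`Circuit.exists_guardedPad_formula`)
from the item-4 file `SparseFormulaMagnificationConverse.lean`. NEW here is the inclusion
`Formula-⊕ ⊆ Formula` in the tree's straight-line model (`XorBottomModelsAE.lean`: gates over
`formulaXorBasis = {∧₂, ∨₂, ¬} ∪ {⊕ₖ}`, fan-out `≤ 1`, parity gates of fan-in `≥ 2` reading inputs,
parity-leaf count `Circuit.xorLeafCount`):

* `Circuit.exists_parityFormulas` — the balanced De Morgan formulas for the parity of `n ≥ 1`
  variables and its complement, `≤ 2n² − 1` leaves each (`(P₁ ∧ Q₂) ∨ (Q₁ ∧ P₂)`);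
* `GateList.exists_unfold` — the TWO-POLARITY UNFOLDING of a straight-line `Formula-⊕` (every gate
  gets a clean De Morgan formula for its value and one for its complement: `∧/∨` by the gate and its
  De Morgan dual, `¬` by swapping polarities, parity gates by the parity formulas over their
  variables of odd multiplicity, `⊕₀`, `⊕₁` by constants / the argument) together with the
  FAN-OUT-ONE LEAF POTENTIAL (as in `MonotoneFormulaBalancing.lean`, `GateList.leaves_potential`,
  whose positional fan-out-one / slot-injectivity / `Unref` vocabulary is reused): summed over the
  gates read by nobody, the leaf sizes are `≤ 2N² ·` (parity-leaf count);
* `Circuit.exists_deMorganFormula_of_formulaXor` — hence a `Formula-⊕` of parity-leaf count `ℓ` on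
  `N ≥ 1` variables is a De Morgan formula of leaf size `≤ 2N²·ℓ`; a.e. class form
  `FORMULAXORae s ⊆ FORMULAae (n ↦ 2n²·s(n))` (`FORMULAXORae_subset_FORMULAae`).

With `s(N) = ⌈N^{1+1}⌉ = N²` the pad formula has `≤ 2N⁴` leaves and its guarded restriction
`≤ n²(2N⁴ + 2) + 2n ≤ n^{4q+3}` leaves for `n ≥ 1254` (`N = 2n + 2 + n^q ≤ 5n^q`), contradicting
`L ∉ FORMULAae (n ↦ n^{4q+3})` (`mem_FORMULAae_of_image_polyPad_mem_FORMULAXORae`).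

Main results: `sparseNPFormulaXorHardAt_one_of_NPNotInFixedPolyFormulas` (quantitative form, `ε = 1`),
`thm11_item2_NP_converse_holds : thm11_item2_NP_converse`, the hypothesis-reduced equivalences
`sparseNPFormulaXorHard_iff_of_thm11_item2` and `formulaXorHard_iff_formulaHard_of_thm11`.

## References

* L. Chen, C. Jin, R. R. Williams, *Hardness Magnification for all Sparse NP Languages*, FOCS 2019,
  1240–1255; ECCC TR19-118, Thm. 1.1 and §4.1 (p. 14). [bib: ChenJinWilliams2019]
* L. Chen, S. Hirahara, I. C. Oliveira, J. Pich, N. Rajgopal, R. Santhanam, *Beyond natural proofs: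
  hardness magnification and locality*, ITCS 2020 / J. ACM 69 (2022), arXiv:1911.08297, §1.1 note B
  and its footnote. [bib: arXiv191108297]
* S. Jukna, *Boolean Function Complexity* (2012), §1.2 (De Morgan formulas, leaf size), §6.1
  (formulas vs. trees). [bib: Jukna2012]
-/

noncomputable section

namespace Literature.Computability.Complexity

open Finset GateList
open Literature.Computability.MetaComplexity

variable {ι : Type*}

/-! ### Parity bookkeeping -/

/-- The number of `true`s of a list is the sum of its indicator. [folklore] -/
private theorem sum_map_ite_eq_count (l : List Bool) :
    (l.map fun b => if b = true then 1 else 0).sum = l.count true := by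
  induction l with
  | nil => simp
  | cons b l ih => cases b <;> simp [ih, Nat.add_comm]

/-- `numOnes w` is the number of `true`s of the list `ofFn w`. [folklore] -/
private theorem numOnes_eq_count_ofFn {k : ℕ} (w : Fin k → Bool) :
    GateFn.numOnes w = (List.ofFn w).count true := by
  unfold GateFn.numOnes
  rw [Finset.card_filter, ← sum_map_ite_eq_count, List.map_ofFn, List.sum_ofFn]
  rfl

/-- Parity of a sum. [folklore] -/
private theorem decide_add_mod_two (c₁ c₂ : ℕ) :
    decide ((c₁ + c₂) % 2 = 1) =
      ((decide (c₁ % 2 = 1) && !decide (c₂ % 2 = 1)) ||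
        (!decide (c₁ % 2 = 1) && decide (c₂ % 2 = 1))) := by
  rcases Nat.mod_two_eq_zero_or_one c₁ with h₁ | h₁ <;>
    rcases Nat.mod_two_eq_zero_or_one c₂ with h₂ | h₂ <;> simp [Nat.add_mod, h₁, h₂]

/-- `(d₁ ↔ d₂) = ¬(d₁ ⊕ d₂)`. [folklore] -/
private theorem bool_xnor (d₁ d₂ : Bool) :
    ((d₁ && d₂) || (!d₁ && !d₂)) = !((d₁ && !d₂) || (!d₁ && d₂)) := by
  cases d₁ <;> cases d₂ <;> rfl

/-- The number of `true`s among `x i`, `i ∈ l`, through the multiplicities of `l`. [folklore] -/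
private theorem count_map_eq_sum {N : ℕ} (l : List (Fin N)) (x : Fin N → Bool) :
    (l.map x).count true = ∑ i : Fin N, l.count i * (if x i = true then 1 else 0) := by
  induction l with
  | nil => simp
  | cons j l ih =>
    rw [List.map_cons, List.count_cons, ih]
    have h : ∀ i : Fin N, (j :: l).count i * (if x i = true then 1 else 0) =
        l.count i * (if x i = true then 1 else 0) +
          (if j = i then (if x i = true then 1 else 0) else 0) := by
      intro i
      rw [List.count_cons]
      by_cases hji : j = i
      · subst hji
        cases x j <;> simp
      · simp [hji]
    rw [Finset.sum_congr rfl fun i _ => h i, Finset.sum_add_distrib, Finset.sum_ite_eq]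
    simp

/-- **Parity over repeated variables is parity over the variables of odd multiplicity.** [folklore] -/
private theorem count_map_mod_two_eq {N : ℕ} (l : List (Fin N)) (x : Fin N → Bool) :
    (l.map x).count true % 2 =
      (((List.finRange N).filter fun i => decide (l.count i % 2 = 1)).map x).count true % 2 := by
  rw [count_map_eq_sum, count_map_eq_sum, Finset.sum_nat_mod]
  conv_rhs => rw [Finset.sum_nat_mod]
  congr 1
  refine Finset.sum_congr rfl fun i _ => ?_
  have hc : ((List.finRange N).filter fun i => decide (l.count i % 2 = 1)).count i =
      if l.count i % 2 = 1 then 1 else 0 := by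
    split_ifs with h
    · exact List.count_eq_one_of_mem ((List.nodup_finRange N).filter _)
        (List.mem_filter.2 ⟨List.mem_finRange i, by simpa using h⟩)
    · exact List.count_eq_zero.2 fun hm => h (by simpa using (List.mem_filter.1 hm).2)
  rw [hc]
  rcases Nat.mod_two_eq_zero_or_one (l.count i) with h | h <;> cases x i <;> simp [h]

/-- The reduced list has at most `N` entries. [folklore] -/
private theorem length_filter_finRange_le {N : ℕ} (p : Fin N → Bool) :
    ((List.finRange N).filter p).length ≤ N :=
  (List.length_filter_le _ _).trans (le_of_eq List.length_finRange)

namespace Circuit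

/-! ### Clean De Morgan formulas: closure under `binop`, literals, constants, parity blocks -/

/-- `∧₂` is a De Morgan gate. [folklore] -/
private theorem and_mem : (⟨2, (GateFn.and 2).2⟩ : GateFn) ∈ deMorganBasis := Set.mem_insert _ _

/-- `∨₂` is a De Morgan gate. [folklore] -/
private theorem or_mem : (⟨2, (GateFn.or 2).2⟩ : GateFn) ∈ deMorganBasis :=
  Set.mem_insert_of_mem _ (Set.mem_insert _ _)

/-- Clean De Morgan formulas are closed under the binary connectives. [folklore] -/
private theorem clean_binop {op : (Fin 2 → Bool) → Bool} (hop : (⟨2, op⟩ : GateFn) ∈ deMorganBasis)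
    {C₁ C₂ : Circuit ι}
    (h₁ : C₁.IsOver deMorganBasis ∧ C₁.IsFormula ∧ ∀ m, C₁.output = .inr m → C₁.refCount m = 0)
    (h₂ : C₂.IsOver deMorganBasis ∧ C₂.IsFormula ∧ ∀ m, C₂.output = .inr m → C₂.refCount m = 0) :
    (binop op C₁ C₂).IsOver deMorganBasis ∧ (binop op C₁ C₂).IsFormula ∧
      ∀ m, (binop op C₁ C₂).output = .inr m → (binop op C₁ C₂).refCount m = 0 :=
  ⟨isOver_binop hop h₁.1 h₂.1, (isFormula_binop op h₁.2.1 h₁.2.2 h₂.2.1 h₂.2.2).1,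
    (isFormula_binop op h₁.2.1 h₁.2.2 h₂.2.1 h₂.2.2).2⟩

/-- A variable is a clean De Morgan formula. [folklore] -/
private theorem clean_input (i : ι) :
    (input i : Circuit ι).IsOver deMorganBasis ∧ (input i : Circuit ι).IsFormula ∧
      ∀ m, (input i : Circuit ι).output = .inr m → (input i : Circuit ι).refCount m = 0 :=
  ⟨isOver_input _ _, (isFormula_input i).1, (isFormula_input i).2⟩

/-- **The two literals of a variable**: clean De Morgan formulas `xᵢ`, `¬xᵢ` with one leaf each.
[cite: Jukna2012, §1.2] -/
theorem exists_literalFormulas (i : ι) : ∃ P Q : Circuit ι,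
    (P.IsOver deMorganBasis ∧ P.IsFormula ∧ ∀ m, P.output = .inr m → P.refCount m = 0) ∧
    (Q.IsOver deMorganBasis ∧ Q.IsFormula ∧ ∀ m, Q.output = .inr m → Q.refCount m = 0) ∧
    P.leafSize = 1 ∧ Q.leafSize = 1 ∧ ∀ x, P.eval x = x i ∧ Q.eval x = !x i := by
  obtain ⟨G, hGB, hGF, hGc, hGl, hGe⟩ := exists_negInput i
  exact ⟨input i, G, clean_input i, ⟨hGB, hGF, hGc⟩, leafSize_input i, hGl,
    fun x => ⟨eval_input i x, hGe x⟩⟩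

/-- **The two constants** over a pointed variable set: clean De Morgan formulas `x₀ ∧ ¬x₀` and
`x₀ ∨ ¬x₀` with two leaves each (the De Morgan basis has no constant gates). [cite: Jukna2012, §1.2] -/
theorem exists_constFormulas (i₀ : ι) : ∃ Z Z' : Circuit ι,
    (Z.IsOver deMorganBasis ∧ Z.IsFormula ∧ ∀ m, Z.output = .inr m → Z.refCount m = 0) ∧
    (Z'.IsOver deMorganBasis ∧ Z'.IsFormula ∧ ∀ m, Z'.output = .inr m → Z'.refCount m = 0) ∧
    Z.leafSize = 2 ∧ Z'.leafSize = 2 ∧ ∀ x, Z.eval x = false ∧ Z'.eval x = true := by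
  obtain ⟨P, Q, hP, hQ, hPl, hQl, he⟩ := exists_literalFormulas i₀
  refine ⟨binop (GateFn.and 2).2 P Q, binop (GateFn.or 2).2 P Q, clean_binop and_mem hP hQ,
    clean_binop or_mem hP hQ, by rw [leafSize_binop, hPl, hQl], by rw [leafSize_binop, hPl, hQl],
    fun x => ?_⟩
  simp only [eval_binop, and_two_apply_pair, or_two_apply_pair, (he x).1, (he x).2]
  cases x i₀ <;> simp

/-- **Balanced parity formulas.** For a nonempty list `l` of `n` variables there are clean De Morgan
formulas `P`, `Q` of the same leaf size `≤ 2n² − 1` computing the parity `⊕_{i ∈ l} xᵢ` and its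
complement: split `l` into halves `l₁, l₂` and take `(P₁ ∧ Q₂) ∨ (Q₁ ∧ P₂)`,
`(P₁ ∧ P₂) ∨ (Q₁ ∧ Q₂)` (the classical `O(n²)` De Morgan formula for parity).
[cite: Jukna2012, §1.2 (De Morgan formulas; parity has formulas of size `O(n²)`)] -/
theorem exists_parityFormulas : ∀ (n : ℕ) (l : List ι), l.length = n → 1 ≤ n →
    ∃ P Q : Circuit ι,
      (P.IsOver deMorganBasis ∧ P.IsFormula ∧ ∀ m, P.output = .inr m → P.refCount m = 0) ∧
      (Q.IsOver deMorganBasis ∧ Q.IsFormula ∧ ∀ m, Q.output = .inr m → Q.refCount m = 0) ∧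
      P.leafSize + 1 ≤ 2 * n ^ 2 ∧ Q.leafSize = P.leafSize ∧
      ∀ x, P.eval x = decide ((l.map x).count true % 2 = 1) ∧
        Q.eval x = !decide ((l.map x).count true % 2 = 1) := by
  intro n
  induction n using Nat.strong_induction_on with
  | _ n ih =>
  intro l hl hn
  by_cases h1 : n = 1
  · subst h1
    obtain ⟨i, rfl⟩ : ∃ i, l = [i] := by
      cases l with
      | nil => simp at hl
      | cons i t =>
        cases t with
        | nil => exact ⟨i, rfl⟩
        | cons _ _ => simp at hl
    obtain ⟨P, Q, hP, hQ, hPl, hQl, he⟩ := exists_literalFormulas i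
    refine ⟨P, Q, hP, hQ, by norm_num [hPl], by rw [hPl, hQl], fun x => ?_⟩
    rw [(he x).1, (he x).2]
    cases hx : x i <;> simp [hx]
  · -- split in halves
    obtain ⟨a, ha⟩ : ∃ a, a = n / 2 := ⟨_, rfl⟩
    obtain ⟨b, hb⟩ : ∃ b, b = n - a := ⟨_, rfl⟩
    have hab : n = a + b := by omega
    have ha1 : 1 ≤ a := by omega
    have hb1 : 1 ≤ b := by omega
    have han : a < n := by omega
    have hbn : b < n := by omega
    have hl₁ : (l.take a).length = a := by rw [List.length_take]; omega
    have hl₂ : (l.drop a).length = b := by rw [List.length_drop]; omega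
    obtain ⟨P₁, Q₁, hP₁, hQ₁, hl₁', hQ₁l, he₁⟩ := ih a han (l.take a) hl₁ ha1
    obtain ⟨P₂, Q₂, hP₂, hQ₂, hl₂', hQ₂l, he₂⟩ := ih b hbn (l.drop a) hl₂ hb1
    refine ⟨binop (GateFn.or 2).2 (binop (GateFn.and 2).2 P₁ Q₂) (binop (GateFn.and 2).2 Q₁ P₂),
      binop (GateFn.or 2).2 (binop (GateFn.and 2).2 P₁ P₂) (binop (GateFn.and 2).2 Q₁ Q₂),
      clean_binop or_mem (clean_binop and_mem hP₁ hQ₂) (clean_binop and_mem hQ₁ hP₂),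
      clean_binop or_mem (clean_binop and_mem hP₁ hP₂) (clean_binop and_mem hQ₁ hQ₂), ?_, ?_,
      fun x => ?_⟩
    · simp only [leafSize_binop, hQ₁l, hQ₂l]
      rw [hab]
      have hb' : b = a ∨ b = a + 1 := by omega
      rcases hb' with rfl | rfl
      · have e : (b + b) ^ 2 = 4 * b ^ 2 := by ring
        omega
      · have e : (a + (a + 1)) ^ 2 = 4 * a ^ 2 + 4 * a + 1 := by ring
        have e' : (a + 1) ^ 2 = a ^ 2 + 2 * a + 1 := by ring
        omega
    · simp only [leafSize_binop, hQ₁l, hQ₂l]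
    · have hsplit : (l.map x).count true =
          ((l.take a).map x).count true + ((l.drop a).map x).count true := by
        rw [← List.count_append, ← List.map_append, List.take_append_drop]
      simp only [eval_binop, and_two_apply_pair, or_two_apply_pair, (he₁ x).1, (he₁ x).2,
        (he₂ x).1, (he₂ x).2, hsplit, decide_add_mod_two, bool_xnor, true_and]

end Circuit

/-! ### Unfolding a straight-line `Formula-⊕` into a two-polarity De Morgan formula -/

namespace GateList

variable {N : ℕ}

/-- The input slots of a two-wire gate. [folklore] -/
private theorem countP_ofFn_two (p : Fin N ⊕ ℕ → Bool) (u v : Fin N ⊕ ℕ) :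
    (List.ofFn ![u, v]).countP p = (if p u then 1 else 0) + (if p v then 1 else 0) := by
  rw [List.ofFn_succ, List.ofFn_succ, List.ofFn_zero]
  simp only [Matrix.cons_val_zero, Matrix.cons_val_succ, List.countP_cons, List.countP_nil]
  split_ifs <;> simp_all

/-- The input slots of a one-wire gate. [folklore] -/
private theorem countP_ofFn_one (p : Fin N ⊕ ℕ → Bool) (w : Fin 1 → Fin N ⊕ ℕ) :
    (List.ofFn w).countP p = if p (w 0) then 1 else 0 := by
  rw [List.ofFn_succ, List.ofFn_zero]
  simp only [List.countP_cons, List.countP_nil, zero_add]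

/-- The value of a parity gate: the parity of the values of its wires. [folklore] -/
private theorem xorGate_op {k : ℕ} (args : Fin k → Fin N ⊕ ℕ) (val : Fin N ⊕ ℕ → Bool) :
    (⟨k, (GateFn.xor k).2, args⟩ : Gate (Fin N)).op
        (fun a => val ((⟨k, (GateFn.xor k).2, args⟩ : Gate (Fin N)).args a)) =
      decide ((List.ofFn fun a : Fin k => val (args a)).count true % 2 = 1) := by
  show decide (GateFn.numOnes _ % 2 = 1) = _
  rw [numOnes_eq_count_ofFn]

open Classical in
/-- **The two-polarity unfolding of a straight-line `Formula-⊕`.** For a well-formed, fan-out-one,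
slot-injective gate list over `formulaXorBasis` whose parity gates of fan-in `≥ 2` read inputs only,
every gate `j` has clean De Morgan formulas `(T j).1`, `(T j).2` of equal leaf size computing the
gate and its complement — `∧₂`/`∨₂` gates by the gate resp. its De Morgan dual on the formulas of
the argument wires, `¬` gates by swapping the two polarities, parity gates by the balanced parity
formulas over their variables of odd multiplicity (`Circuit.exists_parityFormulas`), `⊕₀`/`⊕₁` by
constants / the argument — and the FAN-OUT-ONE LEAF POTENTIAL holds: summed over the gates read by
nobody, the leaf sizes are at most `2N²` times the parity-leaf count of the list (each gate is
charged `2N²` per parity gate and `2N²` per input slot; the formulas of gates that are read have been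
absorbed exactly once). [cite: Jukna2012, §1.2 and §6.1 (formulas, leaf size; a formula with `ℓ` gates has `ℓ + 1` leaves)] -/
theorem exists_unfold (i₀ : Fin N) : ∀ (gs : List (Gate (Fin N))), WF gs →
    (∀ g ∈ gs, g.fn ∈ formulaXorBasis) →
    (∀ g ∈ gs, g.fn ∈ parityGates → 2 ≤ g.arity → ∀ a, (g.args a).isLeft = true) →
    FanOutOne gs → SlotInj gs →
    ∃ T : ℕ → Circuit (Fin N) × Circuit (Fin N),
      (∀ j, j < gs.length →
        ((T j).1.IsOver deMorganBasis ∧ (T j).1.IsFormula ∧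
            ∀ m, (T j).1.output = .inr m → (T j).1.refCount m = 0) ∧
        ((T j).2.IsOver deMorganBasis ∧ (T j).2.IsFormula ∧
            ∀ m, (T j).2.output = .inr m → (T j).2.refCount m = 0) ∧
        (T j).2.leafSize = (T j).1.leafSize ∧
        ∀ x, (T j).1.eval x = (vals gs x).getD j false ∧
          (T j).2.eval x = !(vals gs x).getD j false) ∧
      ∑ m ∈ (range gs.length).filter (Unref gs), (T m).1.leafSize ≤
        2 * N ^ 2 * (gs.map fun g => if g.fn ∈ parityGates then 1
          else (List.ofFn g.args).countP fun w => w.isLeft).sum := by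
  have hN : 0 < N := lt_of_le_of_lt (Nat.zero_le _) i₀.2
  have hN2 : 1 ≤ 2 * N ^ 2 := by nlinarith
  -- literals and constants
  choose Lp Lq hLp hLq hLpl hLql hLe using fun i : Fin N => Circuit.exists_literalFormulas i
  obtain ⟨Z, Z', hZ, hZ', hZl, hZ'l, hZe⟩ := Circuit.exists_constFormulas i₀
  intro gs
  induction gs using List.reverseRecOn with
  | nil =>
    intro _ _ _ _ _
    exact ⟨fun _ => (Z, Z'), fun j hj => absurd hj (by simp), by simp⟩
  | append_singleton pre g ih =>
    intro hwf hB hX hF1 hSI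
    have hwf' : WF pre := hwf.of_append_left
    have hB' : ∀ g' ∈ pre, g'.fn ∈ formulaXorBasis := fun g' hg' => hB g' (by simp [hg'])
    have hX' : ∀ g' ∈ pre, g'.fn ∈ parityGates → 2 ≤ g'.arity → ∀ a, (g'.args a).isLeft = true :=
      fun g' hg' => hX g' (by simp [hg'])
    have hgB : g.fn ∈ formulaXorBasis := hB g (by simp)
    have hgX : g.fn ∈ parityGates → 2 ≤ g.arity → ∀ a, (g.args a).isLeft = true := hX g (by simp)
    obtain ⟨T, hT, IH⟩ := ih hwf' hB' hX' hF1.of_append_left hSI.of_append_left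
    have hOK : GateOK pre.length g := hwf.gateOK_mid (post := [])
    have hget : (pre ++ [g])[pre.length]? = some g := by simp
    -- the gates of `pre` read by `g`
    obtain ⟨R, hR⟩ : ∃ R : Finset ℕ,
        R = (range pre.length).filter fun m => ∃ a : Fin g.arity, g.args a = .inr m := ⟨_, rfl⟩
    have hmemR : ∀ a m, g.args a = .inr m → m ∈ R := fun a m ha => by
      simp only [hR, mem_filter, mem_range]; exact ⟨hOK a m ha, a, ha⟩
    -- the formulas of the wires read by `g`
    let W : Fin N ⊕ ℕ → Circuit (Fin N) × Circuit (Fin N) := Sum.elim (fun i => (Lp i, Lq i)) T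
    have hW : ∀ w : Fin N ⊕ ℕ, (∀ m, w = .inr m → m < pre.length) →
        ((W w).1.IsOver deMorganBasis ∧ (W w).1.IsFormula ∧
            ∀ m, (W w).1.output = .inr m → (W w).1.refCount m = 0) ∧
        ((W w).2.IsOver deMorganBasis ∧ (W w).2.IsFormula ∧
            ∀ m, (W w).2.output = .inr m → (W w).2.refCount m = 0) ∧
        (W w).2.leafSize = (W w).1.leafSize ∧
        ∀ x, (W w).1.eval x = wireOf x (vals pre x) w ∧
          (W w).2.eval x = !wireOf x (vals pre x) w := by
      intro w hw
      cases w with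
      | inl i =>
        refine ⟨hLp i, hLq i, ?_, fun x => hLe i x⟩
        show (Lq i).leafSize = (Lp i).leafSize
        rw [hLpl, hLql]
      | inr m =>
        obtain ⟨h1, h2, h3, h4⟩ := hT m (hw m rfl)
        exact ⟨h1, h2, h3, fun x => h4 x⟩
    -- leaf accounting of one wire and of two distinct slots
    have hacc1 : ∀ a, (W (g.args a)).1.leafSize ≤
        (∑ m ∈ R, (T m).1.leafSize) + 2 * N ^ 2 * (if (g.args a).isLeft then 1 else 0) := by
      intro a
      cases ha : g.args a with
      | inl i =>
        show (Lp i).leafSize ≤ _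
        rw [hLpl i]
        simp only [Sum.isLeft_inl, if_true, mul_one]
        exact le_add_left hN2
      | inr m =>
        show (T m).1.leafSize ≤ _
        exact (single_le_sum (f := fun m => (T m).1.leafSize) (fun _ _ => Nat.zero_le _)
          (hmemR a m ha)).trans (Nat.le_add_right _ _)
    have hacc2 : ∀ a₁ a₂, a₁ ≠ a₂ →
        (W (g.args a₁)).1.leafSize + (W (g.args a₂)).1.leafSize ≤
          (∑ m ∈ R, (T m).1.leafSize) + 2 * N ^ 2 *
            ((if (g.args a₁).isLeft then 1 else 0) + (if (g.args a₂).isLeft then 1 else 0)) := by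
      intro a₁ a₂ hne
      cases h₁ : g.args a₁ with
      | inl i =>
        have h2 := hacc1 a₂
        have e : (W (Sum.inl i)).1.leafSize = 1 := hLpl i
        rw [e]
        simp only [Sum.isLeft_inl, if_true]
        nlinarith
      | inr m₁ =>
        cases h₂ : g.args a₂ with
        | inl i =>
          have h1 := hacc1 a₁
          rw [h₁] at h1
          have e : (W (Sum.inl i)).1.leafSize = 1 := hLpl i
          rw [e]
          simp only [Sum.isLeft_inr, Sum.isLeft_inl, if_true] at h1 ⊢
          nlinarith
        | inr m₂ =>
          have hm : m₁ ≠ m₂ := by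
            intro h; subst h; exact hne (hSI pre.length g a₁ a₂ m₁ hget h₁ h₂)
          have hsub : ({m₁, m₂} : Finset ℕ) ⊆ R := by
            intro m hm'; simp only [mem_insert, mem_singleton] at hm'
            rcases hm' with rfl | rfl
            · exact hmemR a₁ _ h₁
            · exact hmemR a₂ _ h₂
          have := sum_le_sum_of_subset (f := fun m => (T m).1.leafSize) hsub
          rw [sum_pair hm] at this
          show (T m₁).1.leafSize + (T m₂).1.leafSize ≤ _
          exact this.trans (Nat.le_add_right _ _)
    -- the gate `g`: its two formulas
    have hgcases : g.fn = GateFn.and 2 ∨ g.fn = GateFn.or 2 ∨ g.fn = GateFn.not ∨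
        ∃ k, g.fn = GateFn.xor k := by
      rcases (Set.mem_union _ _ _).1 hgB with h | ⟨k, hk⟩
      · simp only [deMorganBasis, Set.mem_insert_iff, Set.mem_singleton_iff] at h
        rcases h with h | h | h
        exacts [Or.inl h, Or.inr (Or.inl h), Or.inr (Or.inr (Or.inl h))]
      · exact Or.inr (Or.inr (Or.inr ⟨k, hk.symm⟩))
    have hnew : ∃ P' Q' : Circuit (Fin N),
        (P'.IsOver deMorganBasis ∧ P'.IsFormula ∧ ∀ m, P'.output = .inr m → P'.refCount m = 0) ∧
        (Q'.IsOver deMorganBasis ∧ Q'.IsFormula ∧ ∀ m, Q'.output = .inr m → Q'.refCount m = 0) ∧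
        Q'.leafSize = P'.leafSize ∧
        (∀ x, P'.eval x = g.op (fun a => wireOf x (vals pre x) (g.args a)) ∧
          Q'.eval x = !g.op (fun a => wireOf x (vals pre x) (g.args a))) ∧
        P'.leafSize ≤ (∑ m ∈ R, (T m).1.leafSize) + 2 * N ^ 2 *
          (if g.fn ∈ parityGates then 1 else (List.ofFn g.args).countP fun w => w.isLeft) := by
      rcases hgcases with h | h | h | ⟨k, hk⟩
      · -- `∧₂`
        have hnp : g.fn ∉ parityGates :=
          not_mem_parityGates_of_mem_deMorganBasis (by simp [h, deMorganBasis])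
        obtain ⟨u, v, rfl⟩ := exists_eq_andGate_of_fn_eq h
        have a0 : (andGate u v).args ⟨0, Nat.zero_lt_two⟩ = u := rfl
        have a1 : (andGate u v).args ⟨1, Nat.one_lt_two⟩ = v := rfl
        obtain ⟨hu1, hu2, hul, hue⟩ := hW u fun m hm => hOK ⟨0, Nat.zero_lt_two⟩ m (by rw [a0, hm])
        obtain ⟨hv1, hv2, hvl, hve⟩ := hW v fun m hm => hOK ⟨1, Nat.one_lt_two⟩ m (by rw [a1, hm])
        refine ⟨Circuit.binop (GateFn.and 2).2 (W u).1 (W v).1,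
          Circuit.binop (GateFn.or 2).2 (W u).2 (W v).2,
          Circuit.clean_binop Circuit.and_mem hu1 hv1, Circuit.clean_binop Circuit.or_mem hu2 hv2,
          by rw [Circuit.leafSize_binop, Circuit.leafSize_binop, hul, hvl], fun x => ?_, ?_⟩
        · rw [andGate_op]
          simp only [Circuit.eval_binop, Circuit.and_two_apply_pair, Circuit.or_two_apply_pair,
            (hue x).1, (hue x).2, (hve x).1, (hve x).2, Bool.not_and, and_self]
        · have h2 := hacc2 ⟨0, Nat.zero_lt_two⟩ ⟨1, Nat.one_lt_two⟩ (Fin.ne_of_val_ne (by norm_num))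
          rw [a0, a1] at h2
          have hc : ((List.ofFn (andGate u v).args).countP fun w => w.isLeft) =
              (if u.isLeft then 1 else 0) + (if v.isLeft then 1 else 0) := countP_ofFn_two _ u v
          rw [if_neg hnp, hc, Circuit.leafSize_binop]
          exact h2
      · -- `∨₂`
        have hnp : g.fn ∉ parityGates :=
          not_mem_parityGates_of_mem_deMorganBasis (by simp [h, deMorganBasis])
        obtain ⟨u, v, rfl⟩ := exists_eq_orGate_of_fn_eq h
        have a0 : (orGate u v).args ⟨0, Nat.zero_lt_two⟩ = u := rfl
        have a1 : (orGate u v).args ⟨1, Nat.one_lt_two⟩ = v := rfl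
        obtain ⟨hu1, hu2, hul, hue⟩ := hW u fun m hm => hOK ⟨0, Nat.zero_lt_two⟩ m (by rw [a0, hm])
        obtain ⟨hv1, hv2, hvl, hve⟩ := hW v fun m hm => hOK ⟨1, Nat.one_lt_two⟩ m (by rw [a1, hm])
        refine ⟨Circuit.binop (GateFn.or 2).2 (W u).1 (W v).1,
          Circuit.binop (GateFn.and 2).2 (W u).2 (W v).2,
          Circuit.clean_binop Circuit.or_mem hu1 hv1, Circuit.clean_binop Circuit.and_mem hu2 hv2,
          by rw [Circuit.leafSize_binop, Circuit.leafSize_binop, hul, hvl], fun x => ?_, ?_⟩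
        · rw [orGate_op]
          simp only [Circuit.eval_binop, Circuit.and_two_apply_pair, Circuit.or_two_apply_pair,
            (hue x).1, (hue x).2, (hve x).1, (hve x).2, Bool.not_or, and_self]
        · have h2 := hacc2 ⟨0, Nat.zero_lt_two⟩ ⟨1, Nat.one_lt_two⟩ (Fin.ne_of_val_ne (by norm_num))
          rw [a0, a1] at h2
          have hc : ((List.ofFn (orGate u v).args).countP fun w => w.isLeft) =
              (if u.isLeft then 1 else 0) + (if v.isLeft then 1 else 0) := countP_ofFn_two _ u v
          rw [if_neg hnp, hc, Circuit.leafSize_binop]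
          exact h2
      · -- `¬`
        have hnp : g.fn ∉ parityGates :=
          not_mem_parityGates_of_mem_deMorganBasis (by simp [h, deMorganBasis])
        obtain ⟨w, rfl⟩ := exists_eq_notGate_of_fn_eq h
        have a0 : (notGate w).args ⟨0, Nat.zero_lt_one⟩ = w := rfl
        obtain ⟨hw1, hw2, hwl, hwe⟩ := hW w fun m hm => hOK ⟨0, Nat.zero_lt_one⟩ m (by rw [a0, hm])
        refine ⟨(W w).2, (W w).1, hw2, hw1, hwl.symm, fun x => ?_, ?_⟩
        · rw [(hwe x).1, (hwe x).2]
          exact ⟨rfl, by show _ = !!(wireOf x (vals pre x) w); rw [Bool.not_not]⟩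
        · have h1 := hacc1 ⟨0, Nat.zero_lt_one⟩
          rw [a0] at h1
          have hc : ((List.ofFn (notGate w).args).countP fun w => w.isLeft) =
              (if w.isLeft then 1 else 0) := countP_ofFn_one _ _
          rw [if_neg hnp, hc, hwl]
          exact h1
      · -- `⊕ₖ`
        have hp : g.fn ∈ parityGates := ⟨k, hk.symm⟩
        rw [if_pos hp, mul_one]
        rcases Nat.lt_or_ge k 2 with hk2 | hk2
        · interval_cases k
          · -- `⊕₀`: the constant `false`
            obtain ⟨args, rfl⟩ : ∃ args : Fin 0 → Fin N ⊕ ℕ, g = ⟨0, (GateFn.xor 0).2, args⟩ :=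
              Gate.exists_eq_of_fn_eq hk
            refine ⟨Z, Z', hZ, hZ', by rw [hZl, hZ'l], fun x => ?_, ?_⟩
            · rw [xorGate_op, (hZe x).1, (hZe x).2, List.ofFn_zero]
              exact ⟨rfl, rfl⟩
            · rw [hZl]
              exact le_add_left (by nlinarith)
          · -- `⊕₁`: the identity
            obtain ⟨args, rfl⟩ : ∃ args : Fin 1 → Fin N ⊕ ℕ, g = ⟨1, (GateFn.xor 1).2, args⟩ :=
              Gate.exists_eq_of_fn_eq hk
            obtain ⟨hw1, hw2, hwl, hwe⟩ := hW (args 0) fun m hm => hOK 0 m hm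
            refine ⟨(W (args 0)).1, (W (args 0)).2, hw1, hw2, hwl, fun x => ?_, ?_⟩
            · rw [xorGate_op, (hwe x).1, (hwe x).2, List.ofFn_succ, List.ofFn_zero]
              cases wireOf x (vals pre x) (args 0) <;> simp
            · exact (hacc1 0).trans (Nat.add_le_add_left
                ((Nat.mul_le_mul_left _ (by split <;> omega)).trans_eq (mul_one _)) _)
        · -- `⊕ₖ`, `k ≥ 2`: all wires are inputs
          obtain ⟨args, rfl⟩ : ∃ args : Fin k → Fin N ⊕ ℕ, g = ⟨k, (GateFn.xor k).2, args⟩ :=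
            Gate.exists_eq_of_fn_eq hk
          have hinp : ∀ a : Fin k, ∃ i, args a = .inl i := fun a => Sum.isLeft_iff.1 (hgX hp hk2 a)
          choose v hv using hinp
          have hfun : ∀ x : Fin N → Bool,
              (fun a : Fin k => wireOf x (vals pre x) (args a)) = x ∘ v := by
            intro x; funext a; rw [hv a]; rfl
          obtain ⟨l, hl⟩ : ∃ l : List (Fin N), l = (List.finRange N).filter fun i =>
            decide ((List.ofFn v).count i % 2 = 1) := ⟨_, rfl⟩
          have hval' : ∀ x, (⟨k, (GateFn.xor k).2, args⟩ : Gate (Fin N)).op (fun a =>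
              wireOf x (vals pre x) ((⟨k, (GateFn.xor k).2, args⟩ : Gate (Fin N)).args a)) =
              decide ((l.map x).count true % 2 = 1) := by
            intro x
            rw [xorGate_op, hfun x, ← List.map_ofFn, count_map_mod_two_eq, ← hl]
          by_cases hl0 : l = []
          · -- every variable occurs evenly often: the constant `false`
            refine ⟨Z, Z', hZ, hZ', by rw [hZl, hZ'l], fun x => ?_, ?_⟩
            · rw [hval' x, (hZe x).1, (hZe x).2, hl0]
              exact ⟨rfl, rfl⟩
            · rw [hZl]
              exact le_add_left (by nlinarith)
          · have hlen : 1 ≤ l.length := by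
              rcases Nat.eq_zero_or_pos l.length with h0 | h0
              · exact absurd (List.eq_nil_of_length_eq_zero h0) hl0
              · exact h0
            have hlenN : l.length ≤ N := by rw [hl]; exact length_filter_finRange_le _
            obtain ⟨P, Q, hP, hQ, hPl, hQl, he⟩ :=
              Circuit.exists_parityFormulas l.length l rfl hlen
            refine ⟨P, Q, hP, hQ, hQl, fun x => ?_, ?_⟩
            · rw [hval' x, (he x).1, (he x).2]
              exact ⟨rfl, rfl⟩
            · refine le_add_left ?_
              calc P.leafSize ≤ 2 * l.length ^ 2 := by omega
                _ ≤ 2 * N ^ 2 := Nat.mul_le_mul_left 2 (Nat.pow_le_pow_left hlenN 2)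
    obtain ⟨P', Q', hP', hQ', hl', he', hacc⟩ := hnew
    -- the new family
    refine ⟨fun j => if j < pre.length then T j else (P', Q'), fun j hj => ?_, ?_⟩
    · dsimp only
      simp only [List.length_append, List.length_singleton] at hj
      by_cases hjp : j < pre.length
      · simp only [if_pos hjp]
        obtain ⟨h1, h2, h3, h4⟩ := hT j hjp
        refine ⟨h1, h2, h3, fun x => ?_⟩
        have hv := wireOf_vals_append pre [g] x (.inr j) (fun m hm => by cases hm; exact hjp)
        simp only [wireOf_inr] at hv
        rw [hv]
        exact h4 x
      · obtain rfl : j = pre.length := by omega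
        simp only [lt_irrefl, if_false]
        refine ⟨hP', hQ', hl', fun x => ?_⟩
        rw [show pre ++ [g] = pre ++ g :: [] from rfl, getD_vals_append_cons]
        exact he' x
    · -- the potential
      dsimp only
      -- the new reference-free set
      have hU : ∀ m, m < pre.length → (Unref (pre ++ [g]) m ↔ Unref pre m ∧ m ∉ R) := by
        intro m hm
        constructor
        · intro h
          refine ⟨fun j g' a hj => h j g' a (by
            have hj' : j < pre.length := (List.getElem?_eq_some_iff.1 hj).1
            rwa [List.getElem?_append_left hj']), fun hmR => ?_⟩
          simp only [hR, mem_filter, mem_range] at hmR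
          obtain ⟨a, ha⟩ := hmR.2
          exact h pre.length g a hget ha
        · rintro ⟨h, hmR⟩ j g' a hj
          by_cases hj' : j < pre.length
          · rw [List.getElem?_append_left hj'] at hj; exact h j g' a hj
          · have hj'' : j = pre.length := by
              have := (List.getElem?_eq_some_iff.1 hj).1; simp at this; omega
            subst hj''
            rw [hget, Option.some.injEq] at hj
            subst hj
            intro ha
            exact hmR (by simp only [hR, mem_filter, mem_range]; exact ⟨hm, a, ha⟩)
      have hUnew : Unref (pre ++ [g]) pre.length := by
        intro j g' a hj ha
        have hj' := (List.getElem?_eq_some_iff.1 hj).1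
        simp only [List.length_append, List.length_singleton] at hj'
        by_cases hjp : j < pre.length
        · rw [List.getElem?_append_left hjp] at hj
          have := hwf' j g' hj a _ ha; omega
        · obtain rfl : j = pre.length := by omega
          rw [hget, Option.some.injEq] at hj; subst hj
          have := hOK a _ ha; omega
      have hRsub : R ⊆ (range pre.length).filter (Unref pre) := by
        intro m hm
        simp only [hR, mem_filter, mem_range] at hm ⊢
        obtain ⟨hm, a, ha⟩ := hm
        refine ⟨hm, fun j g' a' hj ha' => ?_⟩
        have hj' : j < pre.length := (List.getElem?_eq_some_iff.1 hj).1
        have := hF1 j pre.length g' g a' a m (by rwa [List.getElem?_append_left hj']) hget ha' ha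
        omega
      have hsplit : (range (pre ++ [g]).length).filter (Unref (pre ++ [g])) =
          insert pre.length (((range pre.length).filter (Unref pre)) \ R) := by
        ext m
        simp only [List.length_append, List.length_singleton, mem_filter, mem_range, mem_insert,
          mem_sdiff]
        constructor
        · rintro ⟨hm, hu⟩
          by_cases hmp : m = pre.length
          · exact Or.inl hmp
          · have hm' : m < pre.length := by omega
            exact Or.inr ⟨⟨hm', ((hU m hm').1 hu).1⟩, ((hU m hm').1 hu).2⟩
        · rintro (rfl | ⟨⟨hm, hu⟩, hmR⟩)
          · exact ⟨by omega, hUnew⟩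
          · exact ⟨by omega, (hU m hm).2 ⟨hu, hmR⟩⟩
      have hnot : pre.length ∉ ((range pre.length).filter (Unref pre)) \ R := by simp
      rw [hsplit, sum_insert hnot]
      have hold : ∀ m ∈ ((range pre.length).filter (Unref pre)) \ R,
          (if m < pre.length then T m else (P', Q')).1.leafSize = (T m).1.leafSize := by
        intro m hm
        simp only [mem_sdiff, mem_filter, mem_range] at hm
        rw [if_pos hm.1.1]
      rw [sum_congr rfl hold, if_neg (lt_irrefl _)]
      dsimp only
      have hsd := sum_sdiff (f := fun m => (T m).1.leafSize) hRsub
      rw [List.map_append, List.map_singleton, List.sum_append, List.sum_singleton, mul_add]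
      omega

end GateList

namespace Circuit

variable {N : ℕ}

open Classical in
/-- **`Formula-⊕ ⊆ Formula` with a quadratic blow-up (the tree form of CHOPRS's footnote
"Formula-XOR[N^{1.01}] ⊆ Formula[N^{3.01}]").** A straight-line `Formula-⊕` on `N ≥ 1` variables
(gates over `formulaXorBasis`, fan-out `≤ 1`, parity gates of fan-in `≥ 2` reading inputs) with
parity-leaf count `ℓ` is computed by a De Morgan formula of leaf size `≤ 2N²·ℓ`: unfold behind the
output gate (`GateList.exists_unfold`) and read off the potential. [cite: arXiv191108297, §1.1 note B and its footnote (Formula-XOR[N^{1.01}] ⊆ Formula[N^{3.01}])] -/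
theorem exists_deMorganFormula_of_formulaXor (i₀ : Fin N) (C : Circuit (Fin N))
    (hB : C.IsOver formulaXorBasis) (hF : C.IsFormula) (hX : C.XorAtBottom) :
    ∃ D : Circuit (Fin N), D.IsOver deMorganBasis ∧ D.IsFormula ∧
      D.leafSize ≤ 2 * N ^ 2 * C.xorLeafCount ∧ ∀ x, D.eval x = C.eval x := by
  have hN : 0 < N := lt_of_le_of_lt (Nat.zero_le _) i₀.2
  have hx : C.xorLeafCount = (C.gates.map fun g => if g.fn ∈ parityGates then 1
      else (List.ofFn g.args).countP fun w => w.isLeft).sum +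
        (if C.output.isLeft then 1 else 0) := rfl
  cases hout : C.output with
  | inl i =>
    refine ⟨input i, isOver_input _ _, (isFormula_input i).1, ?_, fun x => by
      rw [eval_input, circuit_eval, hout, wireOf_inl]⟩
    rw [leafSize_input, hx, hout]
    simp only [Sum.isLeft_inl, if_true]
    have h1 : 1 ≤ 2 * N ^ 2 := by nlinarith
    calc (1 : ℕ) = 1 * 1 := rfl
      _ ≤ 2 * N ^ 2 * (_ + 1) := Nat.mul_le_mul h1 (by omega)
  | inr m₀ =>
    have hm₀ : m₀ < C.gates.length := C.wf_output m₀ hout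
    set pre := C.gates.take (m₀ + 1) with hpre
    have hsplit : C.gates = pre ++ C.gates.drop (m₀ + 1) := (List.take_append_drop _ _).symm
    have hlen : pre.length = m₀ + 1 := by simp [hpre]; omega
    have hwf : WF pre := by
      have h := wf_gates C; rw [hsplit] at h; exact h.of_append_left
    have hB' : ∀ g ∈ pre, g.fn ∈ formulaXorBasis := fun g hg => hB g (List.mem_of_mem_take hg)
    have hX' : ∀ g ∈ pre, g.fn ∈ parityGates → 2 ≤ g.arity → ∀ a, (g.args a).isLeft = true :=
      fun g hg => hX g (List.mem_of_mem_take hg)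
    have hF1 : GateList.FanOutOne pre := by
      have h := hF.fanOutOne; rw [hsplit] at h; exact h.of_append_left
    have hSI : GateList.SlotInj pre := by
      have h := hF.slotInj; rw [hsplit] at h; exact h.of_append_left
    obtain ⟨T, hT, hpot⟩ := GateList.exists_unfold i₀ pre hwf hB' hX' hF1 hSI
    obtain ⟨h1, -, -, h4⟩ := hT m₀ (by omega)
    refine ⟨(T m₀).1, h1.1, h1.2.1, ?_, fun x => ?_⟩
    · have hmem : m₀ ∈ (range pre.length).filter (GateList.Unref pre) := by
        simp only [mem_filter, mem_range]
        refine ⟨by omega, fun j g a hj ha => ?_⟩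
        have hj := (List.getElem?_eq_some_iff.1 hj).1
        have := hwf j g (by assumption) a m₀ ha
        omega
      have hle := single_le_sum (f := fun m => (T m).1.leafSize) (fun _ _ => Nat.zero_le _) hmem
      have hsum : (pre.map fun g => if g.fn ∈ parityGates then 1
          else (List.ofFn g.args).countP fun w => w.isLeft).sum ≤ C.xorLeafCount := by
        rw [hx, hsplit, List.map_append, List.sum_append]
        omega
      exact hle.trans (hpot.trans (Nat.mul_le_mul_left _ hsum))
    · rw [(h4 x).1, circuit_eval, hout, hsplit, wireOf_vals_append _ _ _ _ (fun m hm => by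
        cases hm; omega), wireOf_inr]

end Circuit

end Literature.Computability.Complexity

namespace Literature.Computability.MetaComplexity

open Literature.Computability.Complexity

/-! ### `Formula-⊕[s] ⊆ Formula[2n²·s]` almost everywhere -/

/-- **CHOPRS's footnote "Formula-XOR[N^{1.01}] ⊆ Formula[N^{3.01}]" in the tree's a.e. classes**:
`FORMULAXORae s ⊆ FORMULAae (n ↦ 2n²·s(n))` — at every length `n ≥ 1` past the threshold convert the
`Formula-⊕` by `Circuit.exists_deMorganFormula_of_formulaXor`; below the threshold any circuit for the
slice will do. [cite: arXiv191108297, §1.1 note B, footnote (Formula-XOR[N^{1.01}] ⊆ Formula[N^{3.01}])] -/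
theorem FORMULAXORae_subset_FORMULAae (s : ℕ → ℕ) :
    FORMULAXORae s ⊆ FORMULAae fun n => 2 * n ^ 2 * s n := by
  rintro L ⟨C, ⟨n₀, hn₀⟩, hdec⟩
  have family : ∀ n : ℕ, ∃ D : Circuit (Fin n),
      (max n₀ 1 ≤ n → D.IsOver deMorganBasis ∧ D.IsFormula ∧ D.leafSize ≤ 2 * n ^ 2 * s n) ∧
      ∀ u : Fin n → Bool, D.eval u = (L : Set (List Bool)).boolIndicator (List.ofFn u) := by
    intro n
    by_cases hn : max n₀ 1 ≤ n
    · obtain ⟨hB, hF, hX, hl⟩ := hn₀ n (le_of_max_le_left hn)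
      obtain ⟨D, hDB, hDF, hDl, hDe⟩ :=
        (C n).exists_deMorganFormula_of_formulaXor ⟨0, le_of_max_le_right hn⟩ hB hF hX
      exact ⟨D, fun _ => ⟨hDB, hDF, hDl.trans (Nat.mul_le_mul_left _ hl)⟩, fun u => by
        rw [hDe, hdec.eval_eq]⟩
    · obtain ⟨D, -, hD⟩ :=
        exists_circuit_eval_eq n fun u => (L : Set (List Bool)).boolIndicator (List.ofFn u)
      exact ⟨D, fun h => absurd h hn, hD⟩
  choose D hD using family
  refine ⟨D, ⟨max n₀ 1, fun n hn => (hD n).1 hn⟩, fun x => ?_⟩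
  have := (hD x.length).2 x.get
  rwa [List.ofFn_get] at this

namespace ChenJinWilliams2019

open Literature.Computability.Complexity.Nondeterministic Literature.Computability.Complexity.Brick

/-! ### The padded language `polyPad q '' L` (as in the circuit, formula and branching-program files) -/

/-- A pad lies in the padded language iff its payload lies in `L` (`polyPad q` is injective: its
first component is the payload). [folklore] -/
private theorem polyPad_mem_image_iff {q : ℕ} {L : Language Bool} {x : List Bool} :
    polyPad q x ∈ polyPad q '' L ↔ x ∈ L :=
  (show Function.Injective (polyPad q) from fun x y h => by simpa using congrArg fstF h).mem_set_image

/-- The indicator of the padded language at a pad is the indicator of `L` at the payload.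
[folklore] -/
private theorem boolIndicator_image_polyPad (q : ℕ) (L : Language Bool) (x : List Bool) :
    (polyPad q '' L).boolIndicator (polyPad q x) = (L : Set (List Bool)).boolIndicator x := by
  by_cases hx : x ∈ L
  · rw [((polyPad q '' L).mem_iff_boolIndicator _).1 (polyPad_mem_image_iff.2 hx),
      ((L : Set (List Bool)).mem_iff_boolIndicator _).1 hx]
  · rw [((polyPad q '' L).notMem_iff_boolIndicator _).1
        (fun h => hx (polyPad_mem_image_iff.1 h)),
      ((L : Set (List Bool)).notMem_iff_boolIndicator _).1 hx]

/-! ### Hardness transfer (print: "This padding argument also works for other computational models") -/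

/-- `⌈N^{1+1}⌉ = N²`. [folklore] -/
private theorem powCeil_one_add_one (N : ℕ) : powCeil (1 + 1) N = N ^ 2 := by
  unfold powCeil
  rw [show (1 : ℝ) + 1 = ((2 : ℕ) : ℝ) by norm_num, Real.rpow_natCast, ← Nat.cast_pow,
    Nat.ceil_natCast]

/-- Size bookkeeping of the transfer: for `1 ≤ q`, `N = 2n + 2 + n^q` and `n ≥ 1254`,
`n²·(2N²·N² + 2) + 2n ≤ 1254·n^{4q+2} ≤ n^{4q+3}`. [folklore] -/
private theorem padLeaf_le₂ {q : ℕ} (hq : 1 ≤ q) {n : ℕ} (hn : 1254 ≤ n) :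
    n * n * (2 * (2 * n + 2 + n ^ q) ^ 2 * (2 * n + 2 + n ^ q) ^ 2 + 2) + 2 * n ≤
      n ^ (4 * q + 3) := by
  have hnq : n ≤ n ^ q := Nat.le_self_pow (by omega) n
  have h5 : 2 * n + 2 + n ^ q ≤ 5 * n ^ q := by omega
  have h4 : (2 * n + 2 + n ^ q) ^ 2 * (2 * n + 2 + n ^ q) ^ 2 ≤ 625 * n ^ (4 * q) :=
    calc (2 * n + 2 + n ^ q) ^ 2 * (2 * n + 2 + n ^ q) ^ 2 = (2 * n + 2 + n ^ q) ^ 4 := by ring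
      _ ≤ (5 * n ^ q) ^ 4 := Nat.pow_le_pow_left h5 4
      _ = 625 * n ^ (4 * q) := by ring
  have h1 : 0 < n ^ (4 * q) := Nat.pos_of_ne_zero (pow_ne_zero _ (by omega))
  have h2 : n ≤ n * n * n ^ (4 * q) := by
    rw [mul_assoc]
    exact Nat.le_mul_of_pos_right n (Nat.mul_pos (by omega) h1)
  have e : 2 * (2 * n + 2 + n ^ q) ^ 2 * (2 * n + 2 + n ^ q) ^ 2 + 2 =
      2 * ((2 * n + 2 + n ^ q) ^ 2 * (2 * n + 2 + n ^ q) ^ 2) + 2 := by ring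
  have h3 : 2 * (2 * n + 2 + n ^ q) ^ 2 * (2 * n + 2 + n ^ q) ^ 2 + 2 ≤ 1252 * n ^ (4 * q) := by
    rw [e]; omega
  calc n * n * (2 * (2 * n + 2 + n ^ q) ^ 2 * (2 * n + 2 + n ^ q) ^ 2 + 2) + 2 * n
      ≤ n * n * (1252 * n ^ (4 * q)) + 2 * (n * n * n ^ (4 * q)) :=
        Nat.add_le_add (Nat.mul_le_mul_left _ h3) (Nat.mul_le_mul_left _ h2)
    _ = 1254 * (n * n * n ^ (4 * q)) := by ring
    _ ≤ n * (n * n * n ^ (4 * q)) := Nat.mul_le_mul_right _ hn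
    _ = n ^ (4 * q + 3) := by ring

/-- Every bit vector is non-constant, all ones, or all zeros. [folklore] -/
private theorem exists_pair_or_eq_const {n : ℕ} (u : Fin n → Bool) :
    (∃ i i', u i = true ∧ u i' = false) ∨ u = (fun _ => true) ∨ u = (fun _ => false) := by
  by_cases h0 : ∃ i', u i' = false
  · by_cases h1 : ∃ i, u i = true
    · obtain ⟨i, hi⟩ := h1
      obtain ⟨i', hi'⟩ := h0
      exact Or.inl ⟨i, i', hi, hi'⟩
    · refine Or.inr (Or.inr (funext fun i => ?_))
      simpa using not_exists.1 h1 i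
  · refine Or.inr (Or.inl (funext fun i => ?_))
    simpa using not_exists.1 h0 i

/-- **Hardness transfer by padding, `U₂-Formula-⊕` to De Morgan formulas.** If the padded language
`polyPad q '' L` (`1 ≤ q`) has `Formula-⊕`'s of parity-leaf count `≤ ⌈N^{1+1}⌉ = N²` at every large
length `N`, then `L` has De Morgan formulas of leaf size `≤ n^{4q+3}` at every large length `n`: at
length `n ≥ 1254` convert the `Formula-⊕` for the pad length `N = 2n + 2 + n^q` into a De Morgan
formula of leaf size `≤ 2N²·N²` (`Circuit.exists_deMorganFormula_of_formulaXor`) and take its guarded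
pad formula (`Circuit.exists_guardedPad_formula`, the constant-free restriction along `u ↦ ⟨u, 1^{n^q}⟩`):
leaf size `≤ n²(2N⁴ + 2) + 2n ≤ n^{4q+3}` (`padLeaf_le₂`). Small lengths: any circuit for the slice.
[cite: ChenJinWilliams2019, Thm. 1.1 (converse of item 2), TR19-118 §4.1 p. 14] -/
theorem mem_FORMULAae_of_image_polyPad_mem_FORMULAXORae {q : ℕ} (hq : 1 ≤ q) {L : Language Bool}
    (h : polyPad q '' L ∈ FORMULAXORae (powCeil (1 + 1))) :
    L ∈ FORMULAae fun n => n ^ (4 * q + 3) := by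
  obtain ⟨C, ⟨N₀, hN₀⟩, hdec⟩ := h
  -- the pad of `u` is read by the formula for the padded language as `[ofFn u ∈ L]`
  have hpad : ∀ (n : ℕ) (u : Fin n → Bool), (C (2 * n + 2 + n ^ q)).eval
      (pairVec u fun _ : Fin (n ^ q) => true) = (L : Set (List Bool)).boolIndicator (List.ofFn u) := by
    intro n u
    rw [hdec.eval_eq, ofFn_pairVec, List.ofFn_const]
    have hpad : boolPair (List.ofFn u) (List.replicate (n ^ q) true) = polyPad q (List.ofFn u) := by
      rw [polyPad, List.length_ofFn]
    rw [hpad, boolIndicator_image_polyPad]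
  -- at every length `n = k + 2` whose pad is long enough: convert, then restrict along the pad
  have main : ∀ k : ℕ, N₀ ≤ 2 * (k + 2) + 2 + (k + 2) ^ q →
      ∃ H : Circuit (Fin (k + 2)), H.IsOver deMorganBasis ∧ H.IsFormula ∧
        H.leafSize ≤ (k + 2) * (k + 2) *
          (2 * (2 * (k + 2) + 2 + (k + 2) ^ q) ^ 2 * (2 * (k + 2) + 2 + (k + 2) ^ q) ^ 2 + 2) +
            2 * (k + 2) ∧
        ∀ u : Fin (k + 2) → Bool, H.eval u = (L : Set (List Bool)).boolIndicator (List.ofFn u) := by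
    intro k hk
    obtain ⟨hB, hF, hX, hl⟩ := hN₀ _ hk
    rw [powCeil_one_add_one] at hl
    obtain ⟨D, hDB, hDF, hDl, hDe⟩ := (C (2 * (k + 2) + 2 + (k + 2) ^ q))
      |>.exists_deMorganFormula_of_formulaXor ⟨0, by omega⟩ hB hF hX
    obtain ⟨H, hHB, hHF, hHl, hmix, h₁, h₀⟩ := D.exists_guardedPad_formula hDB hDF
        ((L : Set (List Bool)).boolIndicator (List.ofFn fun _ : Fin (k + 2) => true))
        ((L : Set (List Bool)).boolIndicator (List.ofFn fun _ : Fin (k + 2) => false))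
    refine ⟨H, hHB, hHF, hHl.trans (Nat.add_le_add_right (Nat.mul_le_mul_left _
      (Nat.add_le_add_right (hDl.trans (Nat.mul_le_mul_left _ hl)) 2)) _), fun u => ?_⟩
    rcases exists_pair_or_eq_const u with hu | rfl | rfl
    · rw [hmix u hu, hDe, hpad]
    · exact h₁
    · exact h₀
  -- the family: from `max N₀ 1254` on the formulas above, anything before
  have family : ∀ n : ℕ, ∃ D : Circuit (Fin n),
      (max N₀ 1254 ≤ n → D.IsOver deMorganBasis ∧ D.IsFormula ∧ D.leafSize ≤ n ^ (4 * q + 3)) ∧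
      ∀ u : Fin n → Bool, D.eval u = (L : Set (List Bool)).boolIndicator (List.ofFn u) := by
    intro n
    by_cases hn : max N₀ 1254 ≤ n
    · have h1254 : 1254 ≤ n := le_of_max_le_right hn
      have hN₀n : N₀ ≤ n := le_of_max_le_left hn
      obtain ⟨k, rfl⟩ : ∃ k, n = k + 2 := ⟨n - 2, by omega⟩
      have hN : N₀ ≤ 2 * (k + 2) + 2 + (k + 2) ^ q := hN₀n.trans (by omega)
      obtain ⟨H, hHB, hHF, hHl, hHe⟩ := main k hN
      exact ⟨H, fun _ => ⟨hHB, hHF, hHl.trans (padLeaf_le₂ hq h1254)⟩, hHe⟩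
    · obtain ⟨D, -, hD⟩ :=
        exists_circuit_eval_eq n fun u => (L : Set (List Bool)).boolIndicator (List.ofFn u)
      exact ⟨D, fun h => absurd h hn, hD⟩
  choose D hD using family
  refine ⟨D, ⟨max N₀ 1254, fun n hn => (hD n).1 hn⟩, fun x => ?_⟩
  have := (hD x.length).2 x.get
  rwa [List.ofFn_get] at this

/-! ### The named fact -/

/-- **Chen–Jin–Williams 2019, Thm. 1.1, converse of item 2 (`C = NP`), quantitative form with
`ε = 1`:** if for every `k` some `NP` language is outside `FORMULAae (n ↦ n^k)`, then for every
`β ∈ (0,1)` some `2^{n^β}`-sparse `NP` language is outside `FORMULAXORae (n ↦ ⌈n^{1+1}⌉)` — namely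
the pad `{⟨x, 1^{|x|^q}⟩ | x ∈ L}`, `q = ⌈1/β⌉`, of an `NP` language `L ∉ FORMULAae (n ↦ n^{4q+3})`.
Printed: TR19-118 §4.1 p. 14, "The ⇐ direction can be proved by a simple padding argument. Set
`ε = 1`. … This padding argument also works for other computational models".
[cite: ChenJinWilliams2019, Thm. 1.1 (converse of item 2), TR19-118 §4.1 p. 14] -/
theorem sparseNPFormulaXorHardAt_one_of_NPNotInFixedPolyFormulas
    (h : ChenJinWilliams2020.NPNotInFixedPolyFormulas) : SparseNPFormulaXorHardAt 1 := by
  intro β hβ0 _hβ1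
  have hq : 1 ≤ ⌈1 / β⌉₊ := Nat.ceil_pos.2 (by positivity)
  have hqβ : 1 ≤ (⌈1 / β⌉₊ : ℝ) * β := by
    have h1 : 1 / β ≤ (⌈1 / β⌉₊ : ℝ) := Nat.le_ceil (1 / β)
    calc (1 : ℝ) = 1 / β * β := by field_simp
      _ ≤ (⌈1 / β⌉₊ : ℝ) * β := mul_le_mul_of_nonneg_right h1 hβ0.le
  obtain ⟨L, hL, hhard⟩ := h (4 * ⌈1 / β⌉₊ + 3)
  exact ⟨polyPad ⌈1 / β⌉₊ '' L, image_polyPad_mem_NP _ hL, isSparse_image_polyPad hβ0 hqβ L,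
    fun hc => hhard (mem_FORMULAae_of_image_polyPad_mem_FORMULAXORae hq hc)⟩

/-- **Discharge of the named fact `thm11_item2_NP_converse`** (Chen–Jin–Williams 2019, Thm. 1.1,
"Moreover, the converse of each item above also holds", item 2, `C = NP`):
`NPNotInFixedPolyFormulas → ∃ ε > 0, SparseNPFormulaXorHardAt ε`, with `ε = 1`.
[cite: ChenJinWilliams2019, Thm. 1.1 (converse of item 2), TR19-118 pp. 4, 14] -/
theorem thm11_item2_NP_converse_holds : thm11_item2_NP_converse :=
  fun h => ⟨1, one_pos, sparseNPFormulaXorHardAt_one_of_NPNotInFixedPolyFormulas h⟩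

/-- Every `ε ∈ [0,1]` works in the converse (antitonicity of `SparseNPFormulaXorHardAt` in `ε`).
[cite: ChenJinWilliams2019, Thm. 1.1 (converse of item 2), TR19-118 §4.1 p. 14] -/
theorem sparseNPFormulaXorHardAt_of_NPNotInFixedPolyFormulas
    (h : ChenJinWilliams2020.NPNotInFixedPolyFormulas) {ε : ℝ} (hε0 : 0 ≤ ε) (hε1 : ε ≤ 1) :
    SparseNPFormulaXorHardAt ε :=
  (sparseNPFormulaXorHardAt_one_of_NPNotInFixedPolyFormulas h).anti hε0 hε1

/-- The printed EQUIVALENCE of Thm. 1.1 item 2 (`C = NP`) with only the magnification direction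
left as a named-fact hypothesis: the sparse-language `Formula-⊕` hypothesis (at some `ε > 0`) holds
iff `NP ⊄ Formula[n^k] ∀ k` (`sparseNPFormulaXorHard_iff` fed with
`thm11_item2_NP_converse_holds`).
[cite: ChenJinWilliams2019, Thm. 1.1 (item 2 and its converse), TR19-118 pp. 3–4, 14] -/
theorem sparseNPFormulaXorHard_iff_of_thm11_item2 (h : thm11_item2_NP) :
    (∃ ε : ℝ, 0 < ε ∧ SparseNPFormulaXorHardAt ε) ↔ ChenJinWilliams2020.NPNotInFixedPolyFormulas :=
  sparseNPFormulaXorHard_iff h thm11_item2_NP_converse_holds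

/-- With both converses proved (`thm11_item2_NP_converse_holds`, `thm11_item4_NP_converse_holds`),
the mutual equivalence of the item-2 and item-4 hypotheses needs only the two magnification
directions. [cite: ChenJinWilliams2019, Thm. 1.1 (items 2, 4 and their converses), TR19-118 pp. 3–4, 14] -/
theorem formulaXorHard_iff_formulaHard_of_thm11 (h₂ : thm11_item2_NP) (h₄ : thm11_item4_NP) :
    (∃ ε : ℝ, 0 < ε ∧ SparseNPFormulaXorHardAt ε) ↔ (∃ ε : ℝ, 0 < ε ∧ SparseNPFormulaHardAt ε) :=
  formulaXorHard_iff_formulaHard h₂ thm11_item2_NP_converse_holds h₄ thm11_item4_NP_converse_holds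

end ChenJinWilliams2019

end Literature.Computability.MetaComplexity
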